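import Mathlib
import HarnessLib
import Summits.NavierStokesRegularity.FluidComputer.GadgetLedger
import Summits.NavierStokesRegularity.FluidComputer.TriggeredTransfer

/-!
# Door N1-FC — the NEGATIVE reading under a detection floor: a certified `η ≤ ηr + δ < m/λ` meets no Kelvin floor

HONEST FRAMING: low prior, high value-of-information experiment on Tao's machine paradigm;
NOT a claim that NS blows up — and not a claim that it does not.

(Cell `ns-blowup`, seat `ns-blowup-fc-prover-2` g3, door N1-FC «forced fluid computer»; companion of
`GadgetDetectionFloor.lean` (same namespace, not imported), which records only the POSITIVE direction
«OneShot → Robust under the detection floor». WHAT THIS IS NOT: not Navier–Stokes evidence and not a reading of any DNS table —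
exact inequalities between real numbers; the identification of the letters `ηr` (a one-shot efficiency
reading), `δ` (its floor), `lam = λ` (scale ratio), `m` (children per parent) with the columns of the
registered DNS protocols PREREG-FC-TRIG-1 and -2 (pub-fluidc) is the cell's MODEL bookkeeping, never the
kernel's; the numerical instance at the end only says that certain RATIONAL inequalities hold.)

* `eta_mul_le_of_reading` / `not_floor_of_reading`: `|ηr - η| ≤ δ`, `λ ≥ 0`, `λ (ηr + δ) ≤ m` give
  `λ η ≤ m`, i.e. the `m`-children FC-AUDIT floor `m/λ < η` (`GadgetLedger`: the level Reynolds numbers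
  climb iff `m/λ < η`) FAILS; `eta_lt_floor_of_reading` is the strict form (`λ (ηr + δ) < m ⇒ η < m/λ`).
* In the tree's vocabularies: `reynoldsRatio_lt_one_of_reading` / `tendsto_packetReynolds_nhds_zero_of_reading`
  (fc-prover-1's ledger over `GadgetSpec`: below the floor the Reynolds ratio `(ηλ/m)^{1/2}` is `< 1` and
  the level Reynolds numbers DIE, `Re_n → 0`), and `TriggerScheme.false_of_reading` /
  `not_exists_triggerScheme_of_reading` (door p416130: a one-child `TriggerScheme` carries the Kelvin floor
  `1 < η λ` as an axiom, so NO scheme has scale ratio `λ` and an efficiency inside a certified window with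
  `λ (ηr + δ) ≤ 1`) — the typed form of «a NO-GO word instantiates no scheme at that (λ, η)».
* `not_kelvin_two_of_reading`: the arithmetic of a reading at `λ = 2`, one child: ANY reading
  `ηr ≤ 349/1000` with ANY floor `δ ≤ 151/1000` certifies `2 η ≤ 1` (numbers of the form printed by a
  class sentence «η_child = 0.349, margin 0.151»; the kernel checks `2 (0.349 + 0.151) ≤ 1`, nothing else).

References: T. Tao, J. Amer. Math. Soc. 29 (2016) §1.3 (one-shot transfer, the Kelvin-critical
bookkeeping) [cite: Tao2016AveragedNS, §1.3]. 0 sorry; axioms ⊆ {propext, Classical.choice, Quot.sound};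
no def, no named fact, no instance asserted.
-/

noncomputable section

namespace Summit.NavierStokesRegularity.FluidComputer.GadgetDetectionFloor

open Filter Topology
open Literature.Analysis.FluidPDE.FluidComputer
open Summit.NavierStokesRegularity.FluidComputer.GadgetLedger
open Summit.NavierStokesRegularity.FluidComputer.TriggeredTransfer

/-! ## From a reading with a floor to the failure of the `m`-children floor -/

/-- A reading `ηr` of `η` with floor `δ` certifies `η ≤ ηr + δ` (the upper half of
`GadgetDetectionFloor.reading_window`). [folklore] -/
theorem eta_le_of_reading {η ηr δ : ℝ} (hread : |ηr - η| ≤ δ) : η ≤ ηr + δ := by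
  linarith [(abs_le.1 hread).1]

/-- A reading `ηr` of `η` with floor `δ` certifies `λ η ≤ λ (ηr + δ)` for `λ ≥ 0`. [folklore] -/
theorem eta_mul_le_of_reading {lam η ηr δ : ℝ} (hlam : 0 ≤ lam) (hread : |ηr - η| ≤ δ) :
    lam * η ≤ lam * (ηr + δ) :=
  mul_le_mul_of_nonneg_left (eta_le_of_reading hread) hlam

/-- **The NEGATIVE reading.** If a one-shot reading `ηr` of the efficiency `η` has detection floor
`δ` (`|ηr - η| ≤ δ`) and even its top `ηr + δ` does not clear the `m`-children floor —
`λ (ηr + δ) ≤ m`, `λ ≥ 0` — then the true efficiency does not clear it: `¬ (m < η λ)` (the FC-AUDIT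
floor `η > m/λ` fails). [folklore] -/
theorem not_floor_of_reading {lam η ηr δ m : ℝ} (hlam : 0 ≤ lam) (hread : |ηr - η| ≤ δ)
    (htop : lam * (ηr + δ) ≤ m) : ¬ m < η * lam := by
  rw [not_lt, mul_comm]
  exact (eta_mul_le_of_reading hlam hread).trans htop

/-- Strict form: `λ (ηr + δ) < m`, `λ > 0` certify `η < m / λ`. [folklore] -/
theorem eta_lt_floor_of_reading {lam η ηr δ m : ℝ} (hlam : 0 < lam) (hread : |ηr - η| ≤ δ)
    (htop : lam * (ηr + δ) < m) : η < m / lam := by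
  rw [lt_div_iff₀ hlam, mul_comm]
  exact (eta_mul_le_of_reading hlam.le hread).trans_lt htop

/-- One child (`m = 1`): `λ (ηr + δ) ≤ 1` certifies the failure of the Kelvin floor `1 < η λ`.
[folklore] -/
theorem not_kelvin_of_reading {lam η ηr δ : ℝ} (hlam : 0 ≤ lam) (hread : |ηr - η| ≤ δ)
    (htop : lam * (ηr + δ) ≤ 1) : ¬ 1 < η * lam :=
  not_floor_of_reading hlam hread htop

/-- Below the Kelvin floor the amplitude growth factor does not exceed one: `λ η ≤ 1`, `η, λ ≥ 0`
give `(η λ)^{1/2} ≤ 1` — the bookkeeping `Re_{k+1} = (ηλ)^{1/2} Re_k` does not climb. [folklore] -/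
theorem sqrt_eta_mul_le_one_of_reading {lam η ηr δ : ℝ} (hlam : 0 ≤ lam) (hread : |ηr - η| ≤ δ)
    (htop : lam * (ηr + δ) ≤ 1) : Real.sqrt (η * lam) ≤ 1 := by
  rw [Real.sqrt_le_one]
  rw [mul_comm]
  exact (eta_mul_le_of_reading hlam hread).trans htop

/-! ## In the tree's vocabularies: the gadget ledger and the trigger scheme -/

/-- **Gadget ledger** (`GadgetLedger`, `m` children): a reading of `σ.eta` with floor `δ` and
`σ.s (ηr + δ) < m` certifies the Reynolds ratio `(ηλ/m)^{1/2} < 1`. [folklore] -/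
theorem reynoldsRatio_lt_one_of_reading (σ : GadgetSpec) (hσ : σ.Valid) {m : ℕ} (hm : 0 < m)
    {ηr δ : ℝ} (hread : |ηr - σ.eta| ≤ δ) (htop : σ.s * (ηr + δ) < m) : reynoldsRatio σ m < 1 :=
  (reynoldsRatio_lt_one_iff (σ := σ) hσ hm).2
    (eta_lt_floor_of_reading (zero_lt_one.trans hσ.one_lt_s) hread htop)

/-- **Gadget ledger, dynamics of the bookkeeping**: under the same certified reading the level
Reynolds numbers of the would-be cascade DIE, `Re_n → 0` (`tendsto_packetReynolds_nhds_zero`).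
[folklore] -/
theorem tendsto_packetReynolds_nhds_zero_of_reading (σ : GadgetSpec) (hσ : σ.Valid) {m : ℕ}
    (hm : 0 < m) (ν E0 : ℝ) {ηr δ : ℝ} (hread : |ηr - σ.eta| ≤ δ) (htop : σ.s * (ηr + δ) < m) :
    Tendsto (packetReynolds σ m ν E0) atTop (𝓝 0) :=
  tendsto_packetReynolds_nhds_zero (σ := σ) hσ hm ν E0
    (eta_lt_floor_of_reading (zero_lt_one.trans hσ.one_lt_s) hread htop)

/-- **Trigger scheme** (door N1-FC, one child): a `TriggerScheme` carries the Kelvin floor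
`1 < η λ` as an axiom; so a scheme whose efficiency `𝒮.eta` is read as `ηr` with floor `δ` and
`𝒮.lam (ηr + δ) ≤ 1` does not exist. [cite: Tao2016AveragedNS, §1.3] -/
theorem _root_.Summit.NavierStokesRegularity.FluidComputer.TriggeredTransfer.TriggerScheme.false_of_reading
    (𝒮 : TriggerScheme) {ηr δ : ℝ} (hread : |ηr - 𝒮.eta| ≤ δ) (htop : 𝒮.lam * (ηr + δ) ≤ 1) :
    False :=
  not_kelvin_of_reading 𝒮.lam_pos.le hread htop 𝒮.kelvin

/-- **«A NO-GO word instantiates no scheme at that `(λ, η)`»**: given a reading `ηr` with floor `δ`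
and `λ (ηr + δ) ≤ 1`, there is NO one-child trigger scheme with scale ratio `λ` and efficiency inside
the certified window. (Other efficiencies, other alphabets, other viscosities are untouched — compare
`TriggeredTransferViscosity.not_transfers_of_not_step`.) [cite: Tao2016AveragedNS, §1.3] -/
theorem not_exists_triggerScheme_of_reading {lam ηr δ : ℝ} (htop : lam * (ηr + δ) ≤ 1) :
    ¬ ∃ 𝒮 : TriggerScheme, 𝒮.lam = lam ∧ |ηr - 𝒮.eta| ≤ δ := by
  rintro ⟨𝒮, hlam, hread⟩
  exact 𝒮.false_of_reading hread (by rwa [hlam])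

/-! ## The arithmetic at `λ = 2`, one child -/

/-- **The numbers at `λ = 2`, one child.** ANY reading `ηr ≤ 349/1000` with ANY floor
`δ ≤ 151/1000` certifies the failure of the Kelvin floor: `¬ (1 < 2 η)` — the kernel checks
`2 · (349/1000 + 151/1000) ≤ 1`, and nothing about any flow. [folklore] -/
theorem not_kelvin_two_of_reading {η ηr δ : ℝ} (hread : |ηr - η| ≤ δ) (hr : ηr ≤ 349 / 1000)
    (hδ : δ ≤ 151 / 1000) : ¬ 1 < η * 2 := by
  refine not_kelvin_of_reading (by norm_num) hread ?_
  calc (2 : ℝ) * (ηr + δ) ≤ 2 * (349 / 1000 + 151 / 1000) := by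
        exact mul_le_mul_of_nonneg_left (add_le_add hr hδ) (by norm_num)
    _ = 1 := by norm_num

/-- The same numbers kill every one-child trigger scheme with `λ = 2` whose efficiency lies in the
certified window: no `TriggerScheme` has `lam = 2` and `|ηr - eta| ≤ δ` with `ηr ≤ 349/1000`,
`δ ≤ 151/1000`. [folklore] -/
theorem not_exists_triggerScheme_two_of_reading {ηr δ : ℝ} (hr : ηr ≤ 349 / 1000)
    (hδ : δ ≤ 151 / 1000) : ¬ ∃ 𝒮 : TriggerScheme, 𝒮.lam = 2 ∧ |ηr - 𝒮.eta| ≤ δ := by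
  refine not_exists_triggerScheme_of_reading ?_
  calc (2 : ℝ) * (ηr + δ) ≤ 2 * (349 / 1000 + 151 / 1000) := by
        exact mul_le_mul_of_nonneg_left (add_le_add hr hδ) (by norm_num)
    _ = 1 := by norm_num

end Summit.NavierStokesRegularity.FluidComputer.GadgetDetectionFloor

end
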